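import Summits.ValiantsHypothesis.ValiantsHypothesis.Theorems.OrderedCountWindowNecessity
import Summits.ValiantsHypothesis.ValiantsHypothesis.Theorems.RyserTripartitionPerLeTripartitionTables
import Summits.ValiantsHypothesis.ValiantsHypothesis.Theses.DecompCycle1
import Literature.Computability.AlgebraicComplexity.SyntacticMultilinearExtension
import HarnessLib

/-!
# ValiantsHypothesis / DecompCycle1 — PLACEMENT of the ordered count-window points below the
# set-multilinear-circuit crux: `PerNotSmVP → PerNotSumOrdered t` (kernel, every `t`)

Decomposition workshop `decomp-valiant`, lens 6 (restricted-models lifting axis), generation 7,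
critic item w1.  The window statement `A_t = PerNotSumOrdered t` of `OrderedCountWindow.lean` says
that `per_n` is not a polynomial-total-width sum of `t(n)` ORDERED (column-)set-multilinear
branching programs.  This file proves the PLACEMENT ARROW

  `DecompCycle1.PerNotSmVP → PerNotSumOrdered t`       (`perNotSumOrdered_of_perNotSmVP`)

for every support function `t`, by the folklore construction the tree did not have: a sum of ordered set-multilinear ABPs of total width `W` for `per_n` IS a fan-in-two
SYNTACTICALLY MULTILINEAR arithmetic circuit of size `poly(n, W)` computing `per_n`
(`exists_smCircuit_of_isSumOrdered`).  Gate by gate (toolkit `SynAvail`,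
`SyntacticMultilinearExtension.lean`): for one program `(σ, C, u, v)` of width `w` the prefix row
vectors `x_p = uᵀ L_0 ⋯ L_{p-1}` (`xvec`; `L_p` = the `w × w` matrix of linear forms of layer `p`,
`layerPoly`, supported on column `σ p`) are built inductively — `x_{p+1}[b] = Σ_a x_p[a] · L_p[a,b]`,
each product multiplying a polynomial supported on the columns `σ 0, …, σ (p-1)` (`prefVars`) with a
linear form supported on column `σ p` (`colVars`): DISJOINT syntactic supports, so every product
gate is syntactically multilinear; then `progPoly = x_n · v` (`progPoly_eq_xvec_dotProduct`) and
`per_n = Σ_{w_i ≠ 0} progPoly_i` (at most `W` summands, as in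
`complexity_perPoly_le_of_isSumOrdered`).  Size `≤ W · (n · W · (2n+2) · W + 2W + 1)`.

Consequence for the dial (workshop node NODE-v7): for every `t`, `VH ⟹ PerNotSmVP (23661) ⟹ A_t ⟹ A_{t'}`
(`t' ≤ t`, `PerNotSumOrdered.anti`): every window point sits BELOW the set-multilinear-circuit
crux of `DecompCycle1`; with `perNotSumOrdered_sqrt` (`t = o(n / log n)` decided in kernel) the
first undecided point of the axis lies in the window `n / log n ≲ t ≤ poly(n)` of [ArvindRaja2016,
§3, open problem after Remark 3.7].  References: [ArvindRaja2016] V. Arvind, S. Raja, Chicago J.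
Theoret. Comput. Sci. 2016, Art. 6, §3 (ROABPs = ordered set-multilinear ABPs; Cor. 3.6);
[RazYehudayoff2008] R. Raz, A. Yehudayoff, Comput. Complexity 17 (2008), §2 (syntactically
multilinear circuits); [Nisan1991Noncommutative] N. Nisan, STOC 1991 (ABPs = iterated matrix products).

HONEST FRAMING: a placement lemma between two OPEN statements of the `ValiantsHypothesis` tree;
neither `PerNotSmVP` nor any `PerNotSumOrdered t` with `t = Ω(n / log n)` is proved here, and
nothing in this file bears on `VP ≠ VNP` itself, which is NOT proved.
-/

-- layout Summits/ValiantsHypothesis/ValiantsHypothesis forces the duplicated namespace component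
set_option linter.dupNamespace false

namespace Summit.ValiantsHypothesis.ValiantsHypothesis.Theorems.OrderedCountWindow

open Literature.Computability.AlgebraicComplexity Matrix
  Literature.Computability.AlgebraicComplexity.ArithCircuit
  Literature.Computability.AlgebraicComplexity.SynAvail
open Literature.Barriers.ValiantsHypothesis (IsPlainGate)
open Summit.ValiantsHypothesis.ValiantsHypothesis.Theorems.RyserTripartition (savail_list_sum)

variable {F : Type*} [Field F]

section Placement
open MvPolynomial
variable {n w : ℕ}

/-! ## Syntactic supports: one column, and the columns already read -/

/-- The variables `X_(row, c)` of column `c`. [folklore] -/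
def colVars (n : ℕ) (c : Fin n) : Finset (Fin n × Fin n) :=
  Finset.univ.filter fun x => x.2 = c

/-- The variables of the first `p` columns read by a program in the order `σ`
(columns `σ 0, …, σ (p-1)`). [cite: ArvindRaja2016, §3 (ROABPs)] -/
def prefVars (σ : Equiv.Perm (Fin n)) (p : ℕ) : Finset (Fin n × Fin n) :=
  Finset.univ.filter fun x => ((σ.symm x.2 : Fin n) : ℕ) < p

/-- The column read in position `p` is disjoint from the columns read before. [folklore] -/
theorem disjoint_prefVars_colVars (σ : Equiv.Perm (Fin n)) (p : Fin n) :
    Disjoint (prefVars σ p) (colVars n (σ p)) := by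
  rw [Finset.disjoint_left]
  intro x hx hx'
  simp only [prefVars, colVars, Finset.mem_filter, Finset.mem_univ, true_and] at hx hx'
  rw [hx', Equiv.symm_apply_apply] at hx
  exact lt_irrefl _ hx

/-- After position `p` the columns read are those before together with column `σ p`. [folklore] -/
theorem prefVars_union_colVars (σ : Equiv.Perm (Fin n)) (p : Fin n) :
    prefVars σ p ∪ colVars n (σ p) ⊆ prefVars σ ((p : ℕ) + 1) := by
  intro x hx
  simp only [prefVars, colVars, Finset.mem_union, Finset.mem_filter, Finset.mem_univ, true_and]
    at hx ⊢
  rcases hx with hx | hx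
  · omega
  · rw [hx, Equiv.symm_apply_apply]
    exact Nat.lt_succ_self _

/-! ## Prefix row vectors of an ordered program -/

/-- The prefix row vector `x_p = uᵀ · L_0 ⋯ L_{p-1}` of the ordered program `(σ, C, u, ·)`
(entries: polynomials in the variables of columns `σ 0, …, σ (p-1)`). [cite: ArvindRaja2016, §3 (ROABPs)] -/
noncomputable def xvec (σ : Equiv.Perm (Fin n)) (Cm : Fin n → Fin n → Matrix (Fin w) (Fin w) F) (u : Fin w → F)
    (p : ℕ) : Fin w → MvPolynomial (Fin n × Fin n) F :=
  (fun a => MvPolynomial.C (u a)) ᵥ* ((List.ofFn (layerPoly σ Cm)).take p).prod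

/-- `x_0 = uᵀ` (constants). [folklore] -/
theorem xvec_zero (σ : Equiv.Perm (Fin n)) (Cm : Fin n → Fin n → Matrix (Fin w) (Fin w) F)
    (u : Fin w → F) : xvec σ Cm u 0 = fun a => MvPolynomial.C (u a) := by
  simp [xvec]

/-- `x_{p+1} = x_p · L_p`. [folklore] -/
theorem xvec_succ (σ : Equiv.Perm (Fin n)) (Cm : Fin n → Fin n → Matrix (Fin w) (Fin w) F)
    (u : Fin w → F) (p : Fin n) :
    xvec σ Cm u ((p : ℕ) + 1) = xvec σ Cm u p ᵥ* layerPoly σ Cm p := by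
  unfold xvec
  have hp : (p : ℕ) < (List.ofFn (layerPoly σ Cm)).length := by simp
  rw [List.prod_take_succ _ _ hp, ← Matrix.vecMul_vecMul]
  congr 1
  simp

/-- `progPoly = x_n · v`: the program polynomial is the last prefix vector paired with `v`
(`uᵀ (P v) = (uᵀ P) v`). [cite: Nisan1991Noncommutative, §2] -/
theorem progPoly_eq_xvec_dotProduct (σ : Equiv.Perm (Fin n))
    (Cm : Fin n → Fin n → Matrix (Fin w) (Fin w) F) (u v : Fin w → F) :
    progPoly σ Cm u v = xvec σ Cm u n ⬝ᵥ fun a => MvPolynomial.C (v a) := by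
  unfold progPoly xvec
  rw [Matrix.dotProduct_mulVec, List.take_of_length_le (by simp)]

/-! ## The gate-by-gate construction (toolkit `SynAvail`) -/

/-- ONE LAYER ENTRY: the linear form `L_p[a,b] = Σ_row C_{p,row}[a,b] · X_(row, σ p)` is available
after `≤ 2n` more gates, with syntactic support inside column `σ p`, in any good gate list.
[cite: ArvindRaja2016, §3 (ROABPs)] -/
theorem avail_layerEntry (σ : Equiv.Perm (Fin n)) (Cm : Fin n → Fin n → Matrix (Fin w) (Fin w) F)
    (p : Fin n) (a b : Fin w) (gs : List (Gate F (Fin n × Fin n)))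
    (hgs : ∀ g ∈ gs, g.fanIn ≤ 2 ∧ IsPlainGate g)
    (hml : ∀ (i : ℕ) (args : List (Operand F (Fin n × Fin n))), gs[i]? = some (.prod args) →
      (args.map (operandVarSet (gateVarSets (gs.take i)))).Pairwise Disjoint) :
    ∃ gs' : List (Gate F (Fin n × Fin n)), gs <+: gs' ∧ (∀ g ∈ gs', g.fanIn ≤ 2 ∧ IsPlainGate g) ∧
      (∀ (i : ℕ) (args : List (Operand F (Fin n × Fin n))), gs'[i]? = some (.prod args) →
        (args.map (operandVarSet (gateVarSets (gs'.take i)))).Pairwise Disjoint) ∧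
      gs'.length ≤ gs.length + 2 * n ∧
      ∃ uo : Operand F (Fin n × Fin n), uo.RefsBelow gs'.length ∧
        uo.eval (gateValues gs') = layerPoly σ Cm p a b ∧
        operandVarSet (gateVarSets gs') uo ⊆ colVars n (σ p) := by
  have h := savail_list_sum (R := F)
    (fun row : Fin n => MvPolynomial.C (Cm p row a b) * X (row, σ p)) (colVars n (σ p)) 1
    (List.finRange n) gs hgs hml ?_
  · obtain ⟨gs', hp', hg', hm', hl', uo, huo, hue, hus⟩ := h
    refine ⟨gs', hp', hg', hm', ?_, uo, huo, ?_, hus⟩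
    · simp only [List.length_finRange] at hl'
      omega
    · rw [hue, ← List.ofFn_eq_map, List.sum_ofFn]
      simp [layerPoly]
  · intro row _ gs₁ _ hg₁ hm₁
    exact sextend_smul (Cm p row a b) hg₁ hm₁
      (savail_X gs₁ (row, σ p) (V := colVars n (σ p)) (by simp [colVars]))

/-- ONE NEW PREFIX ENTRY: if all `x_p[a]` are available with supports in the columns before
position `p`, then `x_{p+1}[b] = Σ_a x_p[a] · L_p[a,b]` is available after `≤ (2n+2)·w` more gates,
support in the columns before position `p+1`; every product gate multiplies DISJOINT supports
(`disjoint_prefVars_colVars`). [cite: RazYehudayoff2008, §2] -/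
theorem avail_xvec_succ_entry (σ : Equiv.Perm (Fin n))
    (Cm : Fin n → Fin n → Matrix (Fin w) (Fin w) F) (u : Fin w → F) (p : Fin n) (b : Fin w)
    (gs : List (Gate F (Fin n × Fin n))) (hgs : ∀ g ∈ gs, g.fanIn ≤ 2 ∧ IsPlainGate g)
    (hml : ∀ (i : ℕ) (args : List (Operand F (Fin n × Fin n))), gs[i]? = some (.prod args) →
      (args.map (operandVarSet (gateVarSets (gs.take i)))).Pairwise Disjoint)
    (hx : ∀ a : Fin w, ∃ uo : Operand F (Fin n × Fin n), uo.RefsBelow gs.length ∧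
      uo.eval (gateValues gs) = xvec σ Cm u p a ∧ operandVarSet (gateVarSets gs) uo ⊆ prefVars σ p) :
    ∃ gs' : List (Gate F (Fin n × Fin n)), gs <+: gs' ∧ (∀ g ∈ gs', g.fanIn ≤ 2 ∧ IsPlainGate g) ∧
      (∀ (i : ℕ) (args : List (Operand F (Fin n × Fin n))), gs'[i]? = some (.prod args) →
        (args.map (operandVarSet (gateVarSets (gs'.take i)))).Pairwise Disjoint) ∧
      gs'.length ≤ gs.length + (2 * n + 2) * w ∧
      ∃ uo : Operand F (Fin n × Fin n), uo.RefsBelow gs'.length ∧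
        uo.eval (gateValues gs') = xvec σ Cm u ((p : ℕ) + 1) b ∧
        operandVarSet (gateVarSets gs') uo ⊆ prefVars σ ((p : ℕ) + 1) := by
  have h := savail_list_sum (R := F)
    (fun a : Fin w => xvec σ Cm u p a * layerPoly σ Cm p a b) (prefVars σ ((p : ℕ) + 1))
    (2 * n + 1) (List.finRange w) gs hgs hml ?_
  · obtain ⟨gs', hp', hg', hm', hl', uo, huo, hue, hus⟩ := h
    refine ⟨gs', hp', hg', hm', ?_, uo, huo, ?_, hus⟩
    · simp only [List.length_finRange] at hl'
      omega
    · rw [hue, ← List.ofFn_eq_map, List.sum_ofFn, xvec_succ]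
      simp [Matrix.vecMul, dotProduct]
  · intro a _ gs₁ hp₁ hg₁ hm₁
    obtain ⟨gs₂, hp₂, hg₂, hm₂, hl₂, hL⟩ := avail_layerEntry σ Cm p a b gs₁ hg₁ hm₁
    obtain ⟨gs₃, hp₃, hg₃, hm₃, hl₃, hu₃⟩ := sextend_mul hg₂ hm₂ (disjoint_prefVars_colVars σ p)
      (savail_mono (hp₁.trans hp₂) (hx a)) hL
    exact ⟨gs₃, hp₂.trans hp₃, hg₃, hm₃, by omega,
      savail_weaken (prefVars_union_colVars σ p) hu₃⟩

/-- ONE STAGE: from all `x_p[a]` to all `x_{p+1}[b]`, after `≤ w · ((2n+2)·w)` more gates.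
[cite: RazYehudayoff2008, §2] -/
theorem avail_xvec_succ (σ : Equiv.Perm (Fin n))
    (Cm : Fin n → Fin n → Matrix (Fin w) (Fin w) F) (u : Fin w → F) (p : Fin n)
    (gs : List (Gate F (Fin n × Fin n))) (hgs : ∀ g ∈ gs, g.fanIn ≤ 2 ∧ IsPlainGate g)
    (hml : ∀ (i : ℕ) (args : List (Operand F (Fin n × Fin n))), gs[i]? = some (.prod args) →
      (args.map (operandVarSet (gateVarSets (gs.take i)))).Pairwise Disjoint)
    (hx : ∀ a : Fin w, ∃ uo : Operand F (Fin n × Fin n), uo.RefsBelow gs.length ∧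
      uo.eval (gateValues gs) = xvec σ Cm u p a ∧ operandVarSet (gateVarSets gs) uo ⊆ prefVars σ p) :
    ∃ gs' : List (Gate F (Fin n × Fin n)), gs <+: gs' ∧ (∀ g ∈ gs', g.fanIn ≤ 2 ∧ IsPlainGate g) ∧
      (∀ (i : ℕ) (args : List (Operand F (Fin n × Fin n))), gs'[i]? = some (.prod args) →
        (args.map (operandVarSet (gateVarSets (gs'.take i)))).Pairwise Disjoint) ∧
      gs'.length ≤ gs.length + ((2 * n + 2) * w) * w ∧
      ∀ b : Fin w, ∃ uo : Operand F (Fin n × Fin n), uo.RefsBelow gs'.length ∧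
        uo.eval (gateValues gs') = xvec σ Cm u ((p : ℕ) + 1) b ∧
        operandVarSet (gateVarSets gs') uo ⊆ prefVars σ ((p : ℕ) + 1) := by
  -- iterate over `b < w`
  let Q : ℕ → List (Gate F (Fin n × Fin n)) → Prop := fun l gs' =>
    ∀ hl : l < w, ∃ uo : Operand F (Fin n × Fin n), uo.RefsBelow gs'.length ∧
      uo.eval (gateValues gs') = xvec σ Cm u ((p : ℕ) + 1) ⟨l, hl⟩ ∧
      operandVarSet (gateVarSets gs') uo ⊆ prefVars σ ((p : ℕ) + 1)
  have hQ : ∀ l (gs₁ gs₂ : List (Gate F (Fin n × Fin n))), gs₁ <+: gs₂ → Q l gs₁ → Q l gs₂ :=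
    fun l gs₁ gs₂ h h₁ hl => savail_mono h (h₁ hl)
  obtain ⟨gs', hp', hg', hm', hl', hQ'⟩ := siterate_extend Q hQ ((2 * n + 2) * w) gs hgs hml w
    (fun l hl gs₁ hp₁ hg₁ hm₁ _ => by
      obtain ⟨gs₂, hp₂, hg₂, hm₂, hl₂, hu₂⟩ :=
        avail_xvec_succ_entry σ Cm u p ⟨l, hl⟩ gs₁ hg₁ hm₁ (fun a => savail_mono hp₁ (hx a))
      exact ⟨gs₂, hp₂, hg₂, hm₂, hl₂, fun _ => hu₂⟩)
  exact ⟨gs', hp', hg', hm', hl', fun b => hQ' b b.isLt b.isLt⟩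

/-- ALL PREFIX VECTORS: for `p ≤ n`, all entries `x_p[a]` are available after
`≤ p · (((2n+2)·w)·w)` gates (support: the columns before position `p`). [cite: RazYehudayoff2008, §2] -/
theorem avail_xvec (σ : Equiv.Perm (Fin n))
    (Cm : Fin n → Fin n → Matrix (Fin w) (Fin w) F) (u : Fin w → F)
    (gs : List (Gate F (Fin n × Fin n))) (hgs : ∀ g ∈ gs, g.fanIn ≤ 2 ∧ IsPlainGate g)
    (hml : ∀ (i : ℕ) (args : List (Operand F (Fin n × Fin n))), gs[i]? = some (.prod args) →
      (args.map (operandVarSet (gateVarSets (gs.take i)))).Pairwise Disjoint) :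
    ∀ p : ℕ, p ≤ n →
    ∃ gs' : List (Gate F (Fin n × Fin n)), gs <+: gs' ∧ (∀ g ∈ gs', g.fanIn ≤ 2 ∧ IsPlainGate g) ∧
      (∀ (i : ℕ) (args : List (Operand F (Fin n × Fin n))), gs'[i]? = some (.prod args) →
        (args.map (operandVarSet (gateVarSets (gs'.take i)))).Pairwise Disjoint) ∧
      gs'.length ≤ gs.length + p * (((2 * n + 2) * w) * w) ∧
      ∀ a : Fin w, ∃ uo : Operand F (Fin n × Fin n), uo.RefsBelow gs'.length ∧
        uo.eval (gateValues gs') = xvec σ Cm u p a ∧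
        operandVarSet (gateVarSets gs') uo ⊆ prefVars σ p := by
  intro p
  induction p with
  | zero =>
    intro _
    exact ⟨gs, List.prefix_rfl, hgs, hml, by simp, fun a => by
      rw [xvec_zero]
      exact savail_C gs (u a) _⟩
  | succ p ih =>
    intro hp
    obtain ⟨gs₁, hp₁, hg₁, hm₁, hl₁, hx₁⟩ := ih (Nat.le_of_succ_le hp)
    obtain ⟨gs₂, hp₂, hg₂, hm₂, hl₂, hx₂⟩ := avail_xvec_succ σ Cm u ⟨p, hp⟩ gs₁ hg₁ hm₁ hx₁
    refine ⟨gs₂, hp₁.trans hp₂, hg₂, hm₂, ?_, hx₂⟩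
    rw [Nat.succ_mul]
    omega

/-- ONE PROGRAM: the polynomial `progPoly σ C u v = uᵀ L_0 ⋯ L_{n-1} v` of an ordered program of
width `w` is available after `≤ n · ((2n+2)·w)·w + 2w` gates in any good gate list, the list staying
plain, fan-in-two and syntactically multilinear. [cite: ArvindRaja2016, §3 (ROABPs)] -/
theorem avail_progPoly (σ : Equiv.Perm (Fin n))
    (Cm : Fin n → Fin n → Matrix (Fin w) (Fin w) F) (u v : Fin w → F)
    (gs : List (Gate F (Fin n × Fin n))) (hgs : ∀ g ∈ gs, g.fanIn ≤ 2 ∧ IsPlainGate g)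
    (hml : ∀ (i : ℕ) (args : List (Operand F (Fin n × Fin n))), gs[i]? = some (.prod args) →
      (args.map (operandVarSet (gateVarSets (gs.take i)))).Pairwise Disjoint) :
    ∃ gs' : List (Gate F (Fin n × Fin n)), gs <+: gs' ∧ (∀ g ∈ gs', g.fanIn ≤ 2 ∧ IsPlainGate g) ∧
      (∀ (i : ℕ) (args : List (Operand F (Fin n × Fin n))), gs'[i]? = some (.prod args) →
        (args.map (operandVarSet (gateVarSets (gs'.take i)))).Pairwise Disjoint) ∧
      gs'.length ≤ gs.length + (n * (((2 * n + 2) * w) * w) + 2 * w) ∧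
      ∃ uo : Operand F (Fin n × Fin n), uo.RefsBelow gs'.length ∧
        uo.eval (gateValues gs') = progPoly σ Cm u v ∧
        operandVarSet (gateVarSets gs') uo ⊆ Finset.univ := by
  obtain ⟨gs₁, hp₁, hg₁, hm₁, hl₁, hx₁⟩ := avail_xvec σ Cm u gs hgs hml n le_rfl
  have h := savail_list_sum (R := F)
    (fun a : Fin w => MvPolynomial.C (v a) * xvec σ Cm u n a) Finset.univ 1 (List.finRange w)
    gs₁ hg₁ hm₁ ?_
  · obtain ⟨gs', hp', hg', hm', hl', uo, huo, hue, -⟩ := h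
    refine ⟨gs', hp₁.trans hp', hg', hm', ?_, uo, huo, ?_, Finset.subset_univ _⟩
    · simp only [List.length_finRange] at hl'
      omega
    · rw [hue, ← List.ofFn_eq_map, List.sum_ofFn, progPoly_eq_xvec_dotProduct]
      simp [dotProduct, mul_comm]
  · intro a _ gs₂ hp₂ hg₂ hm₂
    exact sextend_smul (v a) hg₂ hm₂ (savail_weaken (Finset.subset_univ _)
      (savail_mono hp₂ (hx₁ a)))

/-- **A SUM OF ORDERED PROGRAMS IS A SMALL SYNTACTICALLY MULTILINEAR CIRCUIT.**  If `per_n` is a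
sum of ordered set-multilinear branching programs of total width `W` (any number `t` of summands,
any orders), then `per_n` has a fan-in-two syntactically multilinear circuit of size
`≤ W · (n·((2n+2)·W)·W + 2W + 1)` (drop the width-`0` programs — at most `W` remain — and add the
program circuits of `avail_progPoly`). [cite: ArvindRaja2016, §3 (ROABPs)] -/
theorem exists_smCircuit_of_isSumOrdered {n t W : ℕ} (h : IsSumOrdered F n t W) :
    ∃ P : ArithCircuit F (Fin n × Fin n), P.IsFanInTwo ∧ IsSyntacticallyMultilinear P ∧
      P.Computes (perPoly (Fin n) F) ∧ P.size ≤ W * (n * (((2 * n + 2) * W) * W) + 2 * W + 1) := by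
  classical
  obtain ⟨σ, w, B, hB, hsum, hper⟩ := h
  have hB' := hB
  choose Cm um vm hCuv using hB
  set Φ : Fin t → MvPolynomial (Fin n × Fin n) F := fun i =>
    ∑ J : Fin n → Fin n, MvPolynomial.C (B i (J ∘ ⇑(σ i))) *
      ∏ c, (X (J c, c) : MvPolynomial (Fin n × Fin n) F) with hΦ
  -- `per_n = ∑ Φ i`
  have hperΦ : perPoly (Fin n) F = ∑ i, Φ i := by
    rw [perPoly_eq_sum_perWord]
    simp only [hΦ]
    rw [Finset.sum_comm]
    refine Finset.sum_congr rfl fun J _ => ?_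
    rw [← hper J, map_sum, Finset.sum_mul]
  -- width-`0` programs contribute `0`
  let S : Finset (Fin t) := Finset.univ.filter fun i => w i ≠ 0
  have hΦ0 : ∀ i, i ∉ S → Φ i = 0 := by
    intro i hi
    have hwi : w i = 0 := by simpa [S] using hi
    have hBi : B i = 0 := eq_zero_of_hasNcABPWidthLE_zero (hwi ▸ hB' i)
    simp [hΦ, hBi]
  have hperS : perPoly (Fin n) F = ∑ i ∈ S, Φ i := by
    rw [hperΦ]
    exact (Finset.sum_subset (Finset.subset_univ S) fun i _ hi => hΦ0 i hi).symm
  -- each `Φ i` is the polynomial of program `i`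
  have hΦprog : ∀ i, Φ i = progPoly (σ i) (Cm i) (um i) (vm i) := by
    intro i
    let e : (Fin n → Fin n) ≃ (Fin n → Fin n) :=
      { toFun := fun J => J ∘ ⇑(σ i)
        invFun := fun K => K ∘ ⇑(σ i).symm
        left_inv := fun J => by ext c; simp
        right_inv := fun K => by ext c; simp }
    calc Φ i = ∑ J : Fin n → Fin n, MvPolynomial.C (B i (J ∘ ⇑(σ i))) *
          ∏ c, (X (J c, c) : MvPolynomial (Fin n × Fin n) F) := by simp only [hΦ]
      _ = ∑ J : Fin n → Fin n, (fun K : Fin n → Fin n => MvPolynomial.C (B i K) *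
            ∏ p, (X (K p, σ i p) : MvPolynomial (Fin n × Fin n) F)) (e J) := by
          refine Finset.sum_congr rfl fun J _ => ?_
          show _ = MvPolynomial.C (B i (J ∘ ⇑(σ i))) *
            ∏ p, (X ((J ∘ ⇑(σ i)) p, σ i p) : MvPolynomial _ F)
          rw [← Equiv.prod_comp (σ i) (fun c => (X (J c, c) : MvPolynomial (Fin n × Fin n) F))]
          rfl
      _ = ∑ K : Fin n → Fin n, MvPolynomial.C (B i K) *
            ∏ p, (X (K p, σ i p) : MvPolynomial (Fin n × Fin n) F) :=
          Equiv.sum_comp e (fun K : Fin n → Fin n => MvPolynomial.C (B i K) *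
            ∏ p, (X (K p, σ i p) : MvPolynomial (Fin n × Fin n) F))
      _ = progPoly (σ i) (Cm i) (um i) (vm i) := by
          rw [progPoly_eq_sum]
          simp only [hCuv]
  -- counts
  have hSW : S.card ≤ W := by
    calc S.card = ∑ i ∈ S, 1 := by simp
      _ ≤ ∑ i ∈ S, w i :=
          Finset.sum_le_sum fun i hi => Nat.one_le_iff_ne_zero.2 (Finset.mem_filter.1 hi).2
      _ ≤ ∑ i, w i := Finset.sum_le_sum_of_subset (Finset.subset_univ S)
      _ ≤ W := hsum
  have hwW : ∀ i, w i ≤ W := fun i =>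
    (Finset.single_le_sum (fun j _ => Nat.zero_le (w j)) (Finset.mem_univ i)).trans hsum
  -- the construction: the `|S| ≤ W` program circuits, summed
  have hgs0 : ∀ g ∈ ([] : List (Gate F (Fin n × Fin n))), g.fanIn ≤ 2 ∧ IsPlainGate g := by simp
  obtain ⟨gs, -, hg, hm, hl, uo, -, hue, -⟩ := savail_list_sum (R := F)
    (fun i : Fin t => progPoly (σ i) (Cm i) (um i) (vm i)) Finset.univ
    (n * (((2 * n + 2) * W) * W) + 2 * W) S.toList [] hgs0 prodInv_nil (by
      intro i _ gs₁ _ hg₁ hm₁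
      obtain ⟨gs₂, hp₂, hg₂, hm₂, hl₂, hu₂⟩ := avail_progPoly (σ i) (Cm i) (um i) (vm i) gs₁ hg₁ hm₁
      refine ⟨gs₂, hp₂, hg₂, hm₂, hl₂.trans ?_, hu₂⟩
      have hi := hwW i
      gcongr)
  refine ⟨⟨gs, uo⟩, fun g hg' => (hg g hg').1, isSyntacticallyMultilinear_of_prodInv hm uo, ?_, ?_⟩
  · -- the circuit computes `per_n`
    change uo.eval (gateValues gs) = perPoly (Fin n) F
    rw [hue, hperS, ← Finset.sum_map_toList]
    simp only [hΦprog]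
  · -- size
    change gs.length ≤ W * (n * (((2 * n + 2) * W) * W) + 2 * W + 1)
    rw [List.length_nil, Finset.length_toList, Nat.zero_add] at hl
    calc gs.length ≤ (n * (((2 * n + 2) * W) * W) + 2 * W + 1) * S.card := hl
      _ ≤ (n * (((2 * n + 2) * W) * W) + 2 * W + 1) * W := Nat.mul_le_mul_left _ hSW
      _ = W * (n * (((2 * n + 2) * W) * W) + 2 * W + 1) := Nat.mul_comm _ _

end Placement

/-! ## The placement arrow -/

open Summit.ValiantsHypothesis.ValiantsHypothesis.Theses.DecompCycle1 (PerNotSmVP)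

/-- The size bound of `exists_smCircuit_of_isSumOrdered` at total width `n ^ c + c` is polynomially
bounded in `n`. [folklore] -/
theorem isPBounded_smCircuitBound (c : ℕ) :
    IsPBounded fun n : ℕ =>
      (n ^ c + c) * (n * (((2 * n + 2) * (n ^ c + c)) * (n ^ c + c)) + 2 * (n ^ c + c) + 1) := by
  have hW : IsPBounded fun n : ℕ => n ^ c + c := ⟨c, fun n => le_rfl⟩
  have h2 : IsPBounded fun n : ℕ => 2 * n + 2 :=
    IsPBounded.add_holds (IsPBounded.mul_holds (IsPBounded.const 2) IsPBounded.id) (IsPBounded.const 2)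
  exact IsPBounded.mul_holds hW (IsPBounded.add_holds (IsPBounded.add_holds
    (IsPBounded.mul_holds IsPBounded.id (IsPBounded.mul_holds (IsPBounded.mul_holds h2 hW) hW))
    (IsPBounded.mul_holds (IsPBounded.const 2) hW)) (IsPBounded.const 1))

/-- **PLACEMENT ARROW (kernel, every support function `t`)**: `PerNotSmVP → PerNotSumOrdered t`.
If `per` needs superpolynomial syntactically multilinear circuits (crux `23661` of `DecompCycle1`),
then for every `c` some `per_n` is not a sum of ordered programs of total width `n ^ c + c` — else
`exists_smCircuit_of_isSumOrdered` gives syntactically multilinear circuits of polynomial size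
`isPBounded_smCircuitBound`, contradicting `PerNotSmVP` at that exponent.  Together with
`perNotSumOrdered_of_vh` and `PerNotSumOrdered.anti`: `VH ⟹ 23661 ⟹ A_t ⟹ A_{t'}` (`t' ≤ t`).
[cite: ArvindRaja2016, §3 (ROABPs; open problem after Remark 3.7)] -/
theorem perNotSumOrdered_of_perNotSmVP (t : ℕ → ℕ) (hA : PerNotSmVP) : PerNotSumOrdered t := by
  intro c
  by_contra hc
  push Not at hc
  obtain ⟨c', hc'⟩ := isPBounded_smCircuitBound c
  obtain ⟨n, hn⟩ := hA c'
  obtain ⟨P, hP2, hPsm, hPc, hPs⟩ := exists_smCircuit_of_isSumOrdered (hc n)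
  exact absurd (hn P hP2 hPsm hPc) (not_lt.2 (hPs.trans (hc' n)))

end Summit.ValiantsHypothesis.ValiantsHypothesis.Theorems.OrderedCountWindow
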